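import Literature.NumberTheory.Rogawski1990.UnitFundamentalLemmaExplicitNonsplit   -- ★ p839598 the letter «N7-ns» (+ ★ p839255 (J1)∕(J4′) `nonsplit_clause_of_forall_place_of_eventually`, `eventually_forall_placesOver_isUnramifiedAt`)
import HarnessLib

/-!
# [Rogawski1990 §4.9 Prop. 4.9.1 (b) p. 55; §14.6 p. 242] THE «N7-ns» LETTER SOCKET: a per-place unit fundamental lemma at the NON-SPLIT places under a cofinite
# good-reduction guard ⇒ ★ `UnitFundamentalLemmaExplicitNonsplit(Closed)` — the plug the inert count (Flicker 1998 ∕ [BR₁]) pays `stub_N7ns` through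

Topic `NumberTheory/Rogawski1990`; namespace `Literature.NumberTheory.Rogawski1990`.  THEOREMS ONLY (no definition, no instance, no notation, no named fact, no `sorry`).
Cell `pub/hodgecm-mathlib`, crux H413 = stmt-HodgeConjecture-24833; LEAD F0P3a-plan (g9) WORD T8-33 (o1); seat F0P3-p01 (g12).  HONEST LABEL: HC_CM is proved only modulo the
printed citations until rung 0 closes; nothing printed is asserted here — this is the LAST junction of the inert pipeline: the registered letter `stub_N7ns :
UnitFundamentalLemmaExplicitNonsplitClosed` (closer ED. 18⁺∕19a) is by definition «off a finite `S_bad`, at every `v` with `Subsingleton (PlacesOver L v)`, every canonical pair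
satisfies `IsLocalUnitTransfer` at `Δ‴_v`»; the inert road («D-N7-inert»: ★ JUNCTION-rr, ★ offCount `isLocalUnitTransfer_of_forall_offCount_of_nonsplit`, the count from
[Flicker1998UnitaryFL]) proves `IsLocalUnitTransfer` ONE PLACE AT A TIME under good-reduction guards at a non-split `w ∣ v` (`v` unramified in `L`, `H′_w ∈ GL₃(𝒪_w)`, `μ` unramified at
`w`, levels of mass one).  This file turns such a per-place statement into the letter: the guards hold at every `w ∣ v` for all but finitely many `v` (★
`UnitaryGroup.eventually_forall_unit_placeForm_mem_glInt`, ★ `eventually_forall_placesOver_isUnramifiedAt`, and «only finitely many `v` ramify in `L`»), ★ (J4′)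
`nonsplit_clause_of_forall_place_of_eventually` extracts the cofinite clause (I), and `Subsingleton (PlacesOver L v)` gives `c • w = w` (★ `PlacesOver.galInv`).

* §1 `unitFundamentalLemmaExplicitNonsplit_of_nonsplit_clause` — (I) (★ (J1)'s `hI` shape VERBATIM, any Borel σ-algebras on the orbit spaces) ⇒ the letter at a frame.
* §1 `unitFundamentalLemmaExplicitNonsplit_of_forall_place_of_eventually` — per-place statement under an ABSTRACT cofinite guard `good` ⇒ the letter at a frame.
* §2 `eventually_isUnramifiedIn`, `eventually_forall_placesOver_nonsplitGood` — the concrete inert guard is cofinite; **`unitFundamentalLemmaExplicitNonsplit_of_forall_place`** —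
  per-place statement under the CONCRETE guard (`w`, `c • w = w`, `v` unramified in `L`, `H′_w ∈ GL₃(𝒪_w)`, `μ` unramified at `w`, `νG_v(K′_v) = νH_v(K_{H,v}) = 1`) ⇒ the letter.
* §3 **`unitFundamentalLemmaExplicitNonsplitClosed_of_forall_place`** — the same at every frame of the closed letter ⇒ ★ `UnitFundamentalLemmaExplicitNonsplitClosed` (the `stub_N7ns`
  term of a future closer edition, once the per-place inert lemma is a theorem of the tree).

## References
* [Rogawski1990] J. D. Rogawski, *Automorphic Representations of Unitary Groups in Three Variables* (1990): §4.9 Prop. 4.9.1 (b) p. 55; §4.9 p. 54; §14.6 p. 242.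
* [Flicker1998UnitaryFL] Y. Z. Flicker, *Elementary proof of a fundamental lemma for a unitary group*, Canad. J. Math. 50 (1998): Thm. 15 p. 95.
* [PlatonovRapinchuk1994] V. Platonov, A. Rapinchuk, *Algebraic Groups and Number Theory* (1994): §5.1.
* [CasselsFrohlichANT1967] J. W. S. Cassels, A. Fröhlich (eds.), *Algebraic Number Theory* (1967): Ch. VII Prop. 1.2 (ii).
-/

set_option autoImplicit false

noncomputable section

open NumberField IsDedekindDomain MeasureTheory Measure Filter
open Literature.NumberTheory.Automorphic Literature.NumberTheory.GaloisRepresentations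
open Literature.AlgebraicGeometry.ShimuraVarieties (hermForm)
open scoped Matrix MatrixGroups Classical

namespace Literature.NumberTheory.Rogawski1990

/-- **Only finitely many places of `L⁺` ramify in `L`** (below the prime factors of the different `𝔇 ≠ 0`; Mathlib `dvd_differentIdeal_iff`, `Ideal.finite_factors`) — a local copy of ★
`GaloisRepresentations.finite_setOf_not_isUnramifiedIn` ∕ the private lemma of ★ `LocalUnitaryIntegralLevel` (not imported: keeps the closure light). [cite: CasselsFrohlichANT1967, Ch. VII Prop. 1.2 (ii)] -/
private theorem eventually_isUnramifiedIn (L : Type) [Field L] [NumberField L] :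
    ∀ᶠ v : HeightOneSpectrum (𝓞 ↥(maximalRealSubfield L)) in cofinite, Algebra.IsUnramifiedIn (𝓞 L) v.asIdeal := by
  rw [Filter.eventually_cofinite]
  have hD : differentIdeal (𝓞 ↥(maximalRealSubfield L)) (𝓞 L) ≠ ⊥ := differentIdeal_ne_bot
  have hfin : {Q : HeightOneSpectrum (𝓞 L) | Q.asIdeal ∣ differentIdeal (𝓞 ↥(maximalRealSubfield L)) (𝓞 L)}.Finite := Ideal.finite_factors hD
  refine (hfin.image fun Q => Q.under (𝓞 ↥(maximalRealSubfield L))).subset ?_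
  intro q hq
  simp only [Set.mem_setOf_eq, Algebra.IsUnramifiedIn, not_forall] at hq
  obtain ⟨Q, hQprime, hQover, hQunr⟩ := hq
  haveI := hQprime
  have hQne : Q ≠ ⊥ := Ideal.ne_bot_of_liesOver_of_ne_bot q.ne_bot Q
  refine ⟨⟨Q, hQprime, hQne⟩, ?_, ?_⟩
  · exact dvd_differentIdeal_iff.mpr hQunr
  · exact HeightOneSpectrum.ext hQover.over.symm

/-- **`H` anisotropic ⟹ `det H ≠ 0`** — local copy (as in ★ `LocalTransferExplicitSplit`, ★ `UnitFundamentalLemmaExplicitSplit`). [cite: Rogawski1990, §4.9 p. 54] -/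
private theorem det_ne_zero_of_anisotropic''' {L : Type} [Field L] [NumberField L] [IsCMField L] {H : Matrix (Fin 3) (Fin 3) L}
    (hH0 : ∀ v : Fin 3 → L, hermForm (cmConjRingHom L) H v v = 0 → v = 0) : H.det ≠ 0 := by
  intro hdet
  obtain ⟨v, hv, hHv⟩ := Matrix.exists_mulVec_eq_zero_iff.mpr hdet
  refine hv (hH0 v ?_)
  rw [hermForm, hHv, dotProduct_zero]

section Helpers

variable (L : Type) [Field L] [NumberField L] [IsCMField L]

/-- At a place with ONE place of `L` above it, every `w ∣ v` is fixed by `c` (★ `PlacesOver.galInv`: `c⁻¹ • w` lies over `v` too). [cite: CasselsFrohlichANT1967, Ch. VII Prop. 1.2 (ii)] -/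
theorem smul_eq_of_subsingleton_placesOver {v : HeightOneSpectrum (𝓞 ↥(maximalRealSubfield L))} (hsub : Subsingleton (UnitaryGroup.PlacesOver L v)) (w : UnitaryGroup.PlacesOver L v) :
    IsCMField.complexConj L • w.1 = w.1 := by
  have h : (IsCMField.complexConj L)⁻¹ • w.1 = w.1 :=
    congrArg Subtype.val (Subsingleton.elim (UnitaryGroup.PlacesOver.galInv (IsCMField.complexConj L) w) w)
  calc IsCMField.complexConj L • w.1 = IsCMField.complexConj L • ((IsCMField.complexConj L)⁻¹ • w.1) := by rw [h]
    _ = w.1 := smul_inv_smul _ _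

omit [IsCMField L] in
/-- **The inert good-reduction guard holds at all but finitely many `v`**: `v` unramified in `L`, and at every `w ∣ v`: `H′_w ∈ GL₃(𝒪_w)` and `μ` unramified at `w` — the hypotheses
«`E∕F`, `φ` and `μ` are unramified … `K` hyperspecial» of Prop. 4.9.1 (b) at a non-split `v`, true «for almost all `v`» (§14.6 p. 242). [cite: Rogawski1990, §4.9 Prop. 4.9.1 (b) p. 55; §14.6 p. 242]
[cite: PlatonovRapinchuk1994, §5.1] -/
theorem eventually_forall_placesOver_nonsplitGood (H' : Matrix (Fin 3) (Fin 3) L) (μ : HeckeCharacter L) (hH'u : IsUnit H') :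
    ∀ᶠ v : HeightOneSpectrum (𝓞 ↥(maximalRealSubfield L)) in cofinite, ∀ w : UnitaryGroup.PlacesOver L v,
      Algebra.IsUnramifiedIn (𝓞 L) v.asIdeal ∧ (UnitaryGroup.isUnit_placeForm H' hH'u w.1).unit ∈ glInt 3 (w.1.adicCompletion L) ∧ μ.IsUnramifiedAt w.1 := by
  filter_upwards [eventually_isUnramifiedIn L, UnitaryGroup.eventually_forall_unit_placeForm_mem_glInt 3 H' hH'u,
    eventually_forall_placesOver_isUnramifiedAt L μ] with v hv h3 hμ w
  exact ⟨hv, h3 w, hμ w⟩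

end Helpers

section Frame

variable (L : Type) [Field L] [NumberField L] [IsCMField L] (H' : Matrix (Fin 3) (Fin 3) L) (μ : HeckeCharacter L)
    [∀ v : HeightOneSpectrum (𝓞 ↥(maximalRealSubfield L)),
      MeasurableSpace ((UnitaryGroup.cmDatum L 2 (Matrix.of fun i j : Fin 2 => if i.val + j.val + 1 = 2 then (1 : L) else 0)).Local v ×
        (UnitaryGroup.cmDatum L 1 (Matrix.of fun i j : Fin 1 => if i.val + j.val + 1 = 1 then (1 : L) else 0)).Local v)]
    [∀ v : HeightOneSpectrum (𝓞 ↥(maximalRealSubfield L)),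
      BorelSpace ((UnitaryGroup.cmDatum L 2 (Matrix.of fun i j : Fin 2 => if i.val + j.val + 1 = 2 then (1 : L) else 0)).Local v ×
        (UnitaryGroup.cmDatum L 1 (Matrix.of fun i j : Fin 1 => if i.val + j.val + 1 = 1 then (1 : L) else 0)).Local v)]
    [∀ v : HeightOneSpectrum (𝓞 ↥(maximalRealSubfield L)), MeasurableSpace ((UnitaryGroup.cmDatum L 3 H').Local v)]
    [∀ v : HeightOneSpectrum (𝓞 ↥(maximalRealSubfield L)), BorelSpace ((UnitaryGroup.cmDatum L 3 H').Local v)]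
    (νH : ∀ v : HeightOneSpectrum (𝓞 ↥(maximalRealSubfield L)),
      Measure ((UnitaryGroup.cmDatum L 2 (Matrix.of fun i j : Fin 2 => if i.val + j.val + 1 = 2 then (1 : L) else 0)).Local v ×
        (UnitaryGroup.cmDatum L 1 (Matrix.of fun i j : Fin 1 => if i.val + j.val + 1 = 1 then (1 : L) else 0)).Local v))
    (νG : ∀ v : HeightOneSpectrum (𝓞 ↥(maximalRealSubfield L)), Measure ((UnitaryGroup.cmDatum L 3 H').Local v))
    [∀ v, (νH v).IsHaarMeasure] [∀ v, (νH v).IsMulRightInvariant] [∀ v, (νG v).IsHaarMeasure] [∀ v, (νG v).IsMulRightInvariant]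
    -- σ-algebras on the orbit spaces `H_v ⧸ H_{γ_H}`, `G′_v ⧸ G′_γ`: ARBITRARY Borel structures (the letters fix `borel`; §1 and §3 reduce to that choice)
    [iH : ∀ (v : HeightOneSpectrum (𝓞 ↥(maximalRealSubfield L)))
        (a : (UnitaryGroup.cmDatum L 2 (Matrix.of fun i j : Fin 2 => if i.val + j.val + 1 = 2 then (1 : L) else 0)).Local v ×
          (UnitaryGroup.cmDatum L 1 (Matrix.of fun i j : Fin 1 => if i.val + j.val + 1 = 1 then (1 : L) else 0)).Local v),
        MeasurableSpace (((UnitaryGroup.cmDatum L 2 (Matrix.of fun i j : Fin 2 => if i.val + j.val + 1 = 2 then (1 : L) else 0)).Local v ×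
          (UnitaryGroup.cmDatum L 1 (Matrix.of fun i j : Fin 1 => if i.val + j.val + 1 = 1 then (1 : L) else 0)).Local v) ⧸
          Subgroup.centralizer ({a} : Set ((UnitaryGroup.cmDatum L 2 (Matrix.of fun i j : Fin 2 => if i.val + j.val + 1 = 2 then (1 : L) else 0)).Local v ×
          (UnitaryGroup.cmDatum L 1 (Matrix.of fun i j : Fin 1 => if i.val + j.val + 1 = 1 then (1 : L) else 0)).Local v)))]
    [bH : ∀ (v : HeightOneSpectrum (𝓞 ↥(maximalRealSubfield L)))
        (a : (UnitaryGroup.cmDatum L 2 (Matrix.of fun i j : Fin 2 => if i.val + j.val + 1 = 2 then (1 : L) else 0)).Local v ×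
          (UnitaryGroup.cmDatum L 1 (Matrix.of fun i j : Fin 1 => if i.val + j.val + 1 = 1 then (1 : L) else 0)).Local v),
        BorelSpace (((UnitaryGroup.cmDatum L 2 (Matrix.of fun i j : Fin 2 => if i.val + j.val + 1 = 2 then (1 : L) else 0)).Local v ×
          (UnitaryGroup.cmDatum L 1 (Matrix.of fun i j : Fin 1 => if i.val + j.val + 1 = 1 then (1 : L) else 0)).Local v) ⧸
          Subgroup.centralizer ({a} : Set ((UnitaryGroup.cmDatum L 2 (Matrix.of fun i j : Fin 2 => if i.val + j.val + 1 = 2 then (1 : L) else 0)).Local v ×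
          (UnitaryGroup.cmDatum L 1 (Matrix.of fun i j : Fin 1 => if i.val + j.val + 1 = 1 then (1 : L) else 0)).Local v)))]
    [iG : ∀ (v : HeightOneSpectrum (𝓞 ↥(maximalRealSubfield L))) (γ : (UnitaryGroup.cmDatum L 3 H').Local v),
        MeasurableSpace ((UnitaryGroup.cmDatum L 3 H').Local v ⧸ Subgroup.centralizer ({γ} : Set ((UnitaryGroup.cmDatum L 3 H').Local v)))]
    [bG : ∀ (v : HeightOneSpectrum (𝓞 ↥(maximalRealSubfield L))) (γ : (UnitaryGroup.cmDatum L 3 H').Local v),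
        BorelSpace ((UnitaryGroup.cmDatum L 3 H').Local v ⧸ Subgroup.centralizer ({γ} : Set ((UnitaryGroup.cmDatum L 3 H').Local v)))]

/-! ## §1 From the cofinite non-split clause (I) to the letter -/

/-- **(I) ⇒ «N7-ns» AT A FRAME**: the cofinite non-split clause (I) of ★ (J1) `unitFundamentalLemmaExplicit_of_split_of_nonsplit` (VERBATIM, in ANY Borel σ-algebras `iH bH iG bG` on the orbit
spaces) implies ★ `UnitFundamentalLemmaExplicitNonsplit L H′ μ νH νG` (the letter fixes `borel`; reduced inside, and `Subsingleton (PlacesOver L v) ⇒ ∀ w ∣ v, c • w = w`).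
[cite: Rogawski1990, §4.9 Prop. 4.9.1 (b) p. 55; §14.6 p. 242] -/
theorem unitFundamentalLemmaExplicitNonsplit_of_nonsplit_clause
    (hI : (∀ v : HeightOneSpectrum (𝓞 ↥(maximalRealSubfield L)),
      νG v (UnitaryGroup.cmLocalIntegralLevel L 3 H' v : Set ((UnitaryGroup.cmDatum L 3 H').Local v)) = 1) →
    (∀ v : HeightOneSpectrum (𝓞 ↥(maximalRealSubfield L)),
      νH v (((UnitaryGroup.cmLocalIntegralLevel L 2 (Matrix.of fun i j : Fin 2 => if i.val + j.val + 1 = 2 then (1 : L) else 0) v).prod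
          (UnitaryGroup.cmLocalIntegralLevel L 1 (Matrix.of fun i j : Fin 1 => if i.val + j.val + 1 = 1 then (1 : L) else 0) v) :
            Subgroup ((UnitaryGroup.cmDatum L 2 (Matrix.of fun i j : Fin 2 => if i.val + j.val + 1 = 2 then (1 : L) else 0)).Local v × (UnitaryGroup.cmDatum L 1 (Matrix.of fun i j : Fin 1 => if i.val + j.val + 1 = 1 then (1 : L) else 0)).Local v)) :
          Set ((UnitaryGroup.cmDatum L 2 (Matrix.of fun i j : Fin 2 => if i.val + j.val + 1 = 2 then (1 : L) else 0)).Local v × (UnitaryGroup.cmDatum L 1 (Matrix.of fun i j : Fin 1 => if i.val + j.val + 1 = 1 then (1 : L) else 0)).Local v)) = 1) →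
    ∃ S_i : Finset (HeightOneSpectrum (𝓞 ↥(maximalRealSubfield L))),
      ∀ v : HeightOneSpectrum (𝓞 ↥(maximalRealSubfield L)), v ∉ S_i →
        (∀ w : UnitaryGroup.PlacesOver L v, IsCMField.complexConj L • w.1 = w.1) →
          ∀ (mH : OrbitalMeasureFamily ((UnitaryGroup.cmDatum L 2 (Matrix.of fun i j : Fin 2 => if i.val + j.val + 1 = 2 then (1 : L) else 0)).Local v ×
              (UnitaryGroup.cmDatum L 1 (Matrix.of fun i j : Fin 1 => if i.val + j.val + 1 = 1 then (1 : L) else 0)).Local v))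
            (mG : OrbitalMeasureFamily ((UnitaryGroup.cmDatum L 3 H').Local v)),
            mH.IsCanonical (IsLocalGRegular L v) (νH v) → mG.IsCanonical (fun γ => IsRegularElt (γ.val : GL (Fin 3) (UnitaryGroup.LocalRing L v))) (νG v) →
              IsLocalUnitTransfer L H' v ((finExplicitCollection L H' μ (finExplicitDelta_conj_left_all L H' μ) (finExplicitDelta_conj_right_all L H' μ)) v) mH mG) :
    UnitFundamentalLemmaExplicitNonsplit L H' μ νH νG := by
  obtain rfl : iH = fun _ _ => borel _ := funext fun v => funext fun a => (bH v a).measurable_eq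
  obtain rfl : iG = fun _ _ => borel _ := funext fun v => funext fun γ => (bG v γ).measurable_eq
  intro hKG hKH
  obtain ⟨Si, hSi⟩ := hI hKG hKH
  exact ⟨Si, fun v hv hsub => hSi v hv (smul_eq_of_subsingleton_placesOver L hsub)⟩

/-- **«N7-ns» AT A FRAME FROM A PER-PLACE STATEMENT UNDER AN ABSTRACT COFINITE GUARD**: if `good v w` holds at every `w ∣ v` for all but finitely many `v`, and at every `v` all of
whose `w ∣ v` are fixed by `c`, granted `good` at all `w ∣ v` and the local normalisations, every canonical pair satisfies `IsLocalUnitTransfer` at `Δ‴_v`, then ★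
`UnitFundamentalLemmaExplicitNonsplit L H′ μ νH νG` (★ (J4′) `nonsplit_clause_of_forall_place_of_eventually` + §1). [cite: Rogawski1990, §4.9 Prop. 4.9.1 (b) p. 55; §14.6 p. 242] -/
theorem unitFundamentalLemmaExplicitNonsplit_of_forall_place_of_eventually {good : ∀ v : HeightOneSpectrum (𝓞 ↥(maximalRealSubfield L)), UnitaryGroup.PlacesOver L v → Prop}
    (hgood : ∀ᶠ v : HeightOneSpectrum (𝓞 ↥(maximalRealSubfield L)) in cofinite, ∀ w : UnitaryGroup.PlacesOver L v, good v w)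
    (h : ∀ v : HeightOneSpectrum (𝓞 ↥(maximalRealSubfield L)), (∀ w' : UnitaryGroup.PlacesOver L v, good v w') →
        (∀ w : UnitaryGroup.PlacesOver L v, IsCMField.complexConj L • w.1 = w.1) →
          νG v (UnitaryGroup.cmLocalIntegralLevel L 3 H' v : Set ((UnitaryGroup.cmDatum L 3 H').Local v)) = 1 →
          νH v (((UnitaryGroup.cmLocalIntegralLevel L 2 (Matrix.of fun i j : Fin 2 => if i.val + j.val + 1 = 2 then (1 : L) else 0) v).prod
          (UnitaryGroup.cmLocalIntegralLevel L 1 (Matrix.of fun i j : Fin 1 => if i.val + j.val + 1 = 1 then (1 : L) else 0) v) :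
            Subgroup ((UnitaryGroup.cmDatum L 2 (Matrix.of fun i j : Fin 2 => if i.val + j.val + 1 = 2 then (1 : L) else 0)).Local v × (UnitaryGroup.cmDatum L 1 (Matrix.of fun i j : Fin 1 => if i.val + j.val + 1 = 1 then (1 : L) else 0)).Local v)) :
          Set ((UnitaryGroup.cmDatum L 2 (Matrix.of fun i j : Fin 2 => if i.val + j.val + 1 = 2 then (1 : L) else 0)).Local v × (UnitaryGroup.cmDatum L 1 (Matrix.of fun i j : Fin 1 => if i.val + j.val + 1 = 1 then (1 : L) else 0)).Local v)) = 1 →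
          ∀ (mH : OrbitalMeasureFamily ((UnitaryGroup.cmDatum L 2 (Matrix.of fun i j : Fin 2 => if i.val + j.val + 1 = 2 then (1 : L) else 0)).Local v ×
              (UnitaryGroup.cmDatum L 1 (Matrix.of fun i j : Fin 1 => if i.val + j.val + 1 = 1 then (1 : L) else 0)).Local v))
            (mG : OrbitalMeasureFamily ((UnitaryGroup.cmDatum L 3 H').Local v)),
            mH.IsCanonical (IsLocalGRegular L v) (νH v) → mG.IsCanonical (fun γ => IsRegularElt (γ.val : GL (Fin 3) (UnitaryGroup.LocalRing L v))) (νG v) →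
              IsLocalUnitTransfer L H' v ((finExplicitCollection L H' μ (finExplicitDelta_conj_left_all L H' μ) (finExplicitDelta_conj_right_all L H' μ)) v) mH mG) :
    UnitFundamentalLemmaExplicitNonsplit L H' μ νH νG :=
  unitFundamentalLemmaExplicitNonsplit_of_nonsplit_clause L H' μ νH νG (nonsplit_clause_of_forall_place_of_eventually L H' μ νH νG hgood h)

/-! ## §2 The concrete inert guard -/

/-- **«N7-ns» AT A FRAME FROM THE PER-PLACE INERT UNIT FUNDAMENTAL LEMMA.**  Suppose that at every finite `v` of `L⁺` and every `w ∣ v` fixed by `c` (the place does not split), with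
`v` unramified in `L`, `H′_w ∈ GL₃(𝒪_w)`, `μ` unramified at `w` and `νG_v(K′_v) = νH_v(K_{H,v}) = 1`, every canonical pair satisfies `IsLocalUnitTransfer` at `Δ‴_v` (the shape of ★
`isLocalUnitTransfer_of_forall_offCount_of_nonsplit` once the count discharges its `offCount` binder [Flicker1998UnitaryFL, Thm. 15]).  THEN ★ `UnitFundamentalLemmaExplicitNonsplit L H′ μ νH νG`.
[cite: Rogawski1990, §4.9 Prop. 4.9.1 (b) p. 55; §4.9 p. 54; §14.6 p. 242] [cite: Flicker1998UnitaryFL, Thm. 15 p. 95] -/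
theorem unitFundamentalLemmaExplicitNonsplit_of_forall_place (hH'u : IsUnit H')
    (h :
      ∀ (v : HeightOneSpectrum (𝓞 ↥(maximalRealSubfield L))) (w : UnitaryGroup.PlacesOver L v), IsCMField.complexConj L • w.1 = w.1 →
        Algebra.IsUnramifiedIn (𝓞 L) v.asIdeal → (UnitaryGroup.isUnit_placeForm H' hH'u w.1).unit ∈ glInt 3 (w.1.adicCompletion L) → μ.IsUnramifiedAt w.1 →
          νG v (UnitaryGroup.cmLocalIntegralLevel L 3 H' v : Set ((UnitaryGroup.cmDatum L 3 H').Local v)) = 1 →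
          νH v (((UnitaryGroup.cmLocalIntegralLevel L 2 (Matrix.of fun i j : Fin 2 => if i.val + j.val + 1 = 2 then (1 : L) else 0) v).prod
                (UnitaryGroup.cmLocalIntegralLevel L 1 (Matrix.of fun i j : Fin 1 => if i.val + j.val + 1 = 1 then (1 : L) else 0) v) :
                  Subgroup ((UnitaryGroup.cmDatum L 2 (Matrix.of fun i j : Fin 2 => if i.val + j.val + 1 = 2 then (1 : L) else 0)).Local v × (UnitaryGroup.cmDatum L 1 (Matrix.of fun i j : Fin 1 => if i.val + j.val + 1 = 1 then (1 : L) else 0)).Local v)) :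
                Set ((UnitaryGroup.cmDatum L 2 (Matrix.of fun i j : Fin 2 => if i.val + j.val + 1 = 2 then (1 : L) else 0)).Local v × (UnitaryGroup.cmDatum L 1 (Matrix.of fun i j : Fin 1 => if i.val + j.val + 1 = 1 then (1 : L) else 0)).Local v)) = 1 →
          ∀ (mH : OrbitalMeasureFamily ((UnitaryGroup.cmDatum L 2 (Matrix.of fun i j : Fin 2 => if i.val + j.val + 1 = 2 then (1 : L) else 0)).Local v ×
              (UnitaryGroup.cmDatum L 1 (Matrix.of fun i j : Fin 1 => if i.val + j.val + 1 = 1 then (1 : L) else 0)).Local v))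
            (mG : OrbitalMeasureFamily ((UnitaryGroup.cmDatum L 3 H').Local v)),
            mH.IsCanonical (IsLocalGRegular L v) (νH v) → mG.IsCanonical (fun γ => IsRegularElt (γ.val : GL (Fin 3) (UnitaryGroup.LocalRing L v))) (νG v) →
              IsLocalUnitTransfer L H' v ((finExplicitCollection L H' μ (finExplicitDelta_conj_left_all L H' μ) (finExplicitDelta_conj_right_all L H' μ)) v) mH mG) :
    UnitFundamentalLemmaExplicitNonsplit L H' μ νH νG :=
  unitFundamentalLemmaExplicitNonsplit_of_forall_place_of_eventually L H' μ νH νG (eventually_forall_placesOver_nonsplitGood L H' μ hH'u)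
    fun v hgood hns hKG hKH mH mG hmH hmG =>
      let w : UnitaryGroup.PlacesOver L v := Classical.choice (UnitaryGroup.PlacesOver.nonempty L v)
      h v w (hns w) (hgood w).1 (hgood w).2.1 (hgood w).2.2 hKG hKH mH mG hmH hmG

end Frame

/-! ## §3 The closed socket: `UnitFundamentalLemmaExplicitNonsplitClosed` from the per-place inert lemma at every frame -/

/-- **THE `stub_N7ns` SOCKET** — ★ `UnitFundamentalLemmaExplicitNonsplitClosed` from the per-place inert unit fundamental lemma stated at EVERY frame of the closed letter (CM field `L`, `H′`
hermitian (`hherm`) and anisotropic (`hanis` ⇒ `IsUnit H′`), `μ` unitary with `μ|_{𝕀_{L⁺}} = ω_{L∕L⁺}`, Borel σ-algebras, Haar measures): the term a closer edition writes for `stub_N7ns` once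
the inert count is a theorem of the tree. [cite: Rogawski1990, §4.9 Prop. 4.9.1 (b) p. 55; §14.6 p. 242] [cite: Flicker1998UnitaryFL, Thm. 15 p. 95] -/
theorem unitFundamentalLemmaExplicitNonsplitClosed_of_forall_place
    (h :
    ∀ (L : Type) [Field L] [NumberField L] [IsCMField L] (H' : Matrix (Fin 3) (Fin 3) L) (μ : HeckeCharacter L)
    [∀ v : HeightOneSpectrum (𝓞 ↥(maximalRealSubfield L)),
      MeasurableSpace ((UnitaryGroup.cmDatum L 2 (Matrix.of fun i j : Fin 2 => if i.val + j.val + 1 = 2 then (1 : L) else 0)).Local v ×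
        (UnitaryGroup.cmDatum L 1 (Matrix.of fun i j : Fin 1 => if i.val + j.val + 1 = 1 then (1 : L) else 0)).Local v)]
    [∀ v : HeightOneSpectrum (𝓞 ↥(maximalRealSubfield L)),
      BorelSpace ((UnitaryGroup.cmDatum L 2 (Matrix.of fun i j : Fin 2 => if i.val + j.val + 1 = 2 then (1 : L) else 0)).Local v ×
        (UnitaryGroup.cmDatum L 1 (Matrix.of fun i j : Fin 1 => if i.val + j.val + 1 = 1 then (1 : L) else 0)).Local v)]
    [∀ v : HeightOneSpectrum (𝓞 ↥(maximalRealSubfield L)), MeasurableSpace ((UnitaryGroup.cmDatum L 3 H').Local v)]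
    [∀ v : HeightOneSpectrum (𝓞 ↥(maximalRealSubfield L)), BorelSpace ((UnitaryGroup.cmDatum L 3 H').Local v)]
    (νH : ∀ v : HeightOneSpectrum (𝓞 ↥(maximalRealSubfield L)),
      Measure ((UnitaryGroup.cmDatum L 2 (Matrix.of fun i j : Fin 2 => if i.val + j.val + 1 = 2 then (1 : L) else 0)).Local v ×
        (UnitaryGroup.cmDatum L 1 (Matrix.of fun i j : Fin 1 => if i.val + j.val + 1 = 1 then (1 : L) else 0)).Local v))
    (νG : ∀ v : HeightOneSpectrum (𝓞 ↥(maximalRealSubfield L)), Measure ((UnitaryGroup.cmDatum L 3 H').Local v))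
    [∀ v, (νH v).IsHaarMeasure] [∀ v, (νH v).IsMulRightInvariant] [∀ v, (νG v).IsHaarMeasure] [∀ v, (νG v).IsMulRightInvariant],
    μ.IsUnitary →
    (∀ x : ideleGroup ↥(maximalRealSubfield L), μ (AdeleRing.ideleBaseChange (↥(maximalRealSubfield L)) L x) = quadraticHeckeCharCM L x) →
    (H'.map (cmConjRingHom L)).transpose = H' →
    (∀ x : Fin 3 → L, hermForm (cmConjRingHom L) H' x x = 0 → x = 0) →
    ∀ (hH'u : IsUnit H'),
    letI : ∀ (v : HeightOneSpectrum (𝓞 ↥(maximalRealSubfield L)))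
        (a : ((UnitaryGroup.cmDatum L 2 (Matrix.of fun i j : Fin 2 => if i.val + j.val + 1 = 2 then (1 : L) else 0)).Local v ×
          (UnitaryGroup.cmDatum L 1 (Matrix.of fun i j : Fin 1 => if i.val + j.val + 1 = 1 then (1 : L) else 0)).Local v)),
        MeasurableSpace ((((UnitaryGroup.cmDatum L 2 (Matrix.of fun i j : Fin 2 => if i.val + j.val + 1 = 2 then (1 : L) else 0)).Local v ×
          (UnitaryGroup.cmDatum L 1 (Matrix.of fun i j : Fin 1 => if i.val + j.val + 1 = 1 then (1 : L) else 0)).Local v)) ⧸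
          Subgroup.centralizer ({a} : Set ((UnitaryGroup.cmDatum L 2 (Matrix.of fun i j : Fin 2 => if i.val + j.val + 1 = 2 then (1 : L) else 0)).Local v ×
          (UnitaryGroup.cmDatum L 1 (Matrix.of fun i j : Fin 1 => if i.val + j.val + 1 = 1 then (1 : L) else 0)).Local v))) :=
      fun _ _ => borel _
    haveI : ∀ (v : HeightOneSpectrum (𝓞 ↥(maximalRealSubfield L)))
        (a : ((UnitaryGroup.cmDatum L 2 (Matrix.of fun i j : Fin 2 => if i.val + j.val + 1 = 2 then (1 : L) else 0)).Local v ×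
          (UnitaryGroup.cmDatum L 1 (Matrix.of fun i j : Fin 1 => if i.val + j.val + 1 = 1 then (1 : L) else 0)).Local v)),
        BorelSpace ((((UnitaryGroup.cmDatum L 2 (Matrix.of fun i j : Fin 2 => if i.val + j.val + 1 = 2 then (1 : L) else 0)).Local v ×
          (UnitaryGroup.cmDatum L 1 (Matrix.of fun i j : Fin 1 => if i.val + j.val + 1 = 1 then (1 : L) else 0)).Local v)) ⧸
          Subgroup.centralizer ({a} : Set ((UnitaryGroup.cmDatum L 2 (Matrix.of fun i j : Fin 2 => if i.val + j.val + 1 = 2 then (1 : L) else 0)).Local v ×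
          (UnitaryGroup.cmDatum L 1 (Matrix.of fun i j : Fin 1 => if i.val + j.val + 1 = 1 then (1 : L) else 0)).Local v))) :=
      fun _ _ => ⟨rfl⟩
    letI : ∀ (v : HeightOneSpectrum (𝓞 ↥(maximalRealSubfield L))) (γ : (UnitaryGroup.cmDatum L 3 H').Local v),
        MeasurableSpace ((UnitaryGroup.cmDatum L 3 H').Local v ⧸ Subgroup.centralizer ({γ} : Set ((UnitaryGroup.cmDatum L 3 H').Local v))) :=
      fun _ _ => borel _
    haveI : ∀ (v : HeightOneSpectrum (𝓞 ↥(maximalRealSubfield L))) (γ : (UnitaryGroup.cmDatum L 3 H').Local v),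
        BorelSpace ((UnitaryGroup.cmDatum L 3 H').Local v ⧸ Subgroup.centralizer ({γ} : Set ((UnitaryGroup.cmDatum L 3 H').Local v))) :=
      fun _ _ => ⟨rfl⟩
    ∀ (v : HeightOneSpectrum (𝓞 ↥(maximalRealSubfield L))) (w : UnitaryGroup.PlacesOver L v), IsCMField.complexConj L • w.1 = w.1 →
      Algebra.IsUnramifiedIn (𝓞 L) v.asIdeal → (UnitaryGroup.isUnit_placeForm H' hH'u w.1).unit ∈ glInt 3 (w.1.adicCompletion L) → μ.IsUnramifiedAt w.1 →
        νG v (UnitaryGroup.cmLocalIntegralLevel L 3 H' v : Set ((UnitaryGroup.cmDatum L 3 H').Local v)) = 1 →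
        νH v (((UnitaryGroup.cmLocalIntegralLevel L 2 (Matrix.of fun i j : Fin 2 => if i.val + j.val + 1 = 2 then (1 : L) else 0) v).prod
              (UnitaryGroup.cmLocalIntegralLevel L 1 (Matrix.of fun i j : Fin 1 => if i.val + j.val + 1 = 1 then (1 : L) else 0) v) :
                Subgroup ((UnitaryGroup.cmDatum L 2 (Matrix.of fun i j : Fin 2 => if i.val + j.val + 1 = 2 then (1 : L) else 0)).Local v × (UnitaryGroup.cmDatum L 1 (Matrix.of fun i j : Fin 1 => if i.val + j.val + 1 = 1 then (1 : L) else 0)).Local v)) :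
              Set ((UnitaryGroup.cmDatum L 2 (Matrix.of fun i j : Fin 2 => if i.val + j.val + 1 = 2 then (1 : L) else 0)).Local v × (UnitaryGroup.cmDatum L 1 (Matrix.of fun i j : Fin 1 => if i.val + j.val + 1 = 1 then (1 : L) else 0)).Local v)) = 1 →
        ∀ (mH : OrbitalMeasureFamily ((UnitaryGroup.cmDatum L 2 (Matrix.of fun i j : Fin 2 => if i.val + j.val + 1 = 2 then (1 : L) else 0)).Local v ×
            (UnitaryGroup.cmDatum L 1 (Matrix.of fun i j : Fin 1 => if i.val + j.val + 1 = 1 then (1 : L) else 0)).Local v))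
          (mG : OrbitalMeasureFamily ((UnitaryGroup.cmDatum L 3 H').Local v)),
          mH.IsCanonical (IsLocalGRegular L v) (νH v) → mG.IsCanonical (fun γ => IsRegularElt (γ.val : GL (Fin 3) (UnitaryGroup.LocalRing L v))) (νG v) →
            IsLocalUnitTransfer L H' v ((finExplicitCollection L H' μ (finExplicitDelta_conj_left_all L H' μ) (finExplicitDelta_conj_right_all L H' μ)) v) mH mG) :
    UnitFundamentalLemmaExplicitNonsplitClosed :=
  fun L _ _ _ H' μ _ _ _ _ νH νG _ _ _ _ hμu hμω hherm hanis => by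
    letI : ∀ (v : HeightOneSpectrum (𝓞 ↥(maximalRealSubfield L)))
        (a : ((UnitaryGroup.cmDatum L 2 (Matrix.of fun i j : Fin 2 => if i.val + j.val + 1 = 2 then (1 : L) else 0)).Local v ×
          (UnitaryGroup.cmDatum L 1 (Matrix.of fun i j : Fin 1 => if i.val + j.val + 1 = 1 then (1 : L) else 0)).Local v)),
        MeasurableSpace ((((UnitaryGroup.cmDatum L 2 (Matrix.of fun i j : Fin 2 => if i.val + j.val + 1 = 2 then (1 : L) else 0)).Local v ×
          (UnitaryGroup.cmDatum L 1 (Matrix.of fun i j : Fin 1 => if i.val + j.val + 1 = 1 then (1 : L) else 0)).Local v)) ⧸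
          Subgroup.centralizer ({a} : Set ((UnitaryGroup.cmDatum L 2 (Matrix.of fun i j : Fin 2 => if i.val + j.val + 1 = 2 then (1 : L) else 0)).Local v ×
          (UnitaryGroup.cmDatum L 1 (Matrix.of fun i j : Fin 1 => if i.val + j.val + 1 = 1 then (1 : L) else 0)).Local v))) :=
      fun _ _ => borel _
    haveI : ∀ (v : HeightOneSpectrum (𝓞 ↥(maximalRealSubfield L)))
        (a : ((UnitaryGroup.cmDatum L 2 (Matrix.of fun i j : Fin 2 => if i.val + j.val + 1 = 2 then (1 : L) else 0)).Local v ×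
          (UnitaryGroup.cmDatum L 1 (Matrix.of fun i j : Fin 1 => if i.val + j.val + 1 = 1 then (1 : L) else 0)).Local v)),
        BorelSpace ((((UnitaryGroup.cmDatum L 2 (Matrix.of fun i j : Fin 2 => if i.val + j.val + 1 = 2 then (1 : L) else 0)).Local v ×
          (UnitaryGroup.cmDatum L 1 (Matrix.of fun i j : Fin 1 => if i.val + j.val + 1 = 1 then (1 : L) else 0)).Local v)) ⧸
          Subgroup.centralizer ({a} : Set ((UnitaryGroup.cmDatum L 2 (Matrix.of fun i j : Fin 2 => if i.val + j.val + 1 = 2 then (1 : L) else 0)).Local v ×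
          (UnitaryGroup.cmDatum L 1 (Matrix.of fun i j : Fin 1 => if i.val + j.val + 1 = 1 then (1 : L) else 0)).Local v))) :=
      fun _ _ => ⟨rfl⟩
    letI : ∀ (v : HeightOneSpectrum (𝓞 ↥(maximalRealSubfield L))) (γ : (UnitaryGroup.cmDatum L 3 H').Local v),
        MeasurableSpace ((UnitaryGroup.cmDatum L 3 H').Local v ⧸ Subgroup.centralizer ({γ} : Set ((UnitaryGroup.cmDatum L 3 H').Local v))) :=
      fun _ _ => borel _
    haveI : ∀ (v : HeightOneSpectrum (𝓞 ↥(maximalRealSubfield L))) (γ : (UnitaryGroup.cmDatum L 3 H').Local v),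
        BorelSpace ((UnitaryGroup.cmDatum L 3 H').Local v ⧸ Subgroup.centralizer ({γ} : Set ((UnitaryGroup.cmDatum L 3 H').Local v))) :=
      fun _ _ => ⟨rfl⟩
    have hH'u : IsUnit H' := (Matrix.isUnit_iff_isUnit_det H').2 (Ne.isUnit (det_ne_zero_of_anisotropic''' hanis))
    exact unitFundamentalLemmaExplicitNonsplit_of_forall_place L H' μ νH νG hH'u (h L H' μ νH νG hμu hμω hherm hanis hH'u)

end Literature.NumberTheory.Rogawski1990

end
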